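import Literature.Analysis.FluidPDE.AlbrittonBarker2020LocalConcentration
import Literature.Analysis.FluidPDE.SuitableWeakInBallTools
import Literature.Analysis.FluidPDE.LocalTypeIProofs
import Literature.Analysis.FluidPDE.LocalTypeIPersistenceHolds
import Literature.Analysis.FluidPDE.LocalLerayBackwardUniquenessAnyDatum
import HarnessLib

/-!
# Albritton–Barker 2020, Thm. 3.1 (interior case): the blow-up rescaling (Step 2) and the
# endgame (Step 7 with `ε = 0`) of the printed proof

Analysis/FluidPDE proofs file (theorems only: no definition, no named fact, no `sorry`) on the
discharge path of the named fact
`Literature.Analysis.FluidPDE.albrittonBarker2020_localWeakL3_regularity`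
(`AlbrittonBarker2020LocalConcentration.lean`; D. Albritton, T. Barker, *Localised necessary
conditions for singularity formation in the Navier–Stokes equations with curved boundary*,
J. Differential Equations 269 (2020) 7529–7573 = arXiv:1811.00507, Thm. 3.1 + Rmk. 3.4, read in the
held text `paper:arxiv-1811.00507`, chunks c9–c13).

## The printed proof (§3, pp. c9–c13) and what this file proves of it

The proof of Thm. 3.1 is by contradiction: assume `z* = (x*,1)` is a singular point (c9).
* Step 1 (truncation, Prop. 2.2) and Steps 3–4 (energy estimates by a Calderón-type splitting of
  `V(·,t_k)`, Stokes-semigroup smoothing, Gronwall; maximal regularity of Giga–Sohr for `∂ₜV`,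
  `∇²V`, `∇Q`) produce UNIFORM a priori bounds for the rescaled truncated solutions
  `V^{(k)}(y,s) = R_k V(R_k y, t_k + R_k² s)`, `R_k = √(1 − t_k)` ((3.12), (3.14)–(3.18)). These
  steps use engines the tree does not have (Leray–Hopf theory with forcing and weak–strong
  uniqueness on a bounded `C²` domain, the Stokes semigroup and its `L_p` smoothing there,
  Giga–Sohr maximal regularity, Bogovskiĭ's operator with `L^{3,∞}` bounds) and are NOT proved
  here; they are the «needs X» of the cell memo `pub/ns-inputs/kits/A10-needsX-lit-a10.md`.
* **Step 2 (rescaling and key norm relations, (3.6)–(3.8)) — proved here (§2–§5)** in the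
  tree's vocabulary, for the zoom at the vertex `z* = (1,x*)` at any scale `θ > 0`,
  `U(s,y) = θ v(1 + θ² s, x* + θ y)`, `P(s,y) = θ² q(1 + θ² s, x* + θ y)` (the tree's
  `θ • stPull (θ^2) θ 1 x* v`; the print zooms at `(t_k, x*)` with `s ∈ ]0,1[`, which is the same
  map up to the time shift `s ↦ s − 1`; with `θ = R_k` the time `t_k` becomes `s = −1` and the
  terminal time `1` becomes `s = 0`): the class `IsSuitableWeakSolutionInBall` passes from
  `Q(z*,1)` to `Q(0,1/θ)` (`IsSuitableWeakSolutionInBall.zoom_radius`, the accepted `.zoom` being the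
  case of equal radius and scale), boundedness below the top time, the weak `L²`-continuity of the
  slices, the weak-`L³` slice bound `‖U(·,(t−1)/θ²)‖_{L^{3,∞}(B(0,ρ/θ))} = ‖v(·,t)‖_{L^{3,∞}(B(x*,ρ))}`
  (scale invariance of `L^{3,∞}`, in the distribution form of the fact, without loss), the
  terminal-slice smallness, and the singular vertex are transported
  (`albrittonBarker2020_blowupSequence`).
* **Steps 5–6 (flattening is void in the interior case, Rmk. 3.4; passage to the limit, (3.37)) —
  packaged here BY NAME (§6)** from the tree's PROVED `SuitableCompactness_holds` and
  `PersistenceOfSingularities_holds` (`LocalTypeIProofs.lean`, `LocalTypeIPersistenceHolds.lean`):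
  IF the zooms are uniformly bounded in `L³ × L^{3/2}(Q(0,1))` (the output of Steps 1/3/4), a
  subsequence converges to a suitable weak solution singular at the origin
  (`exists_singular_limit_of_uniform_bounds`, `albrittonBarker2020_singular_blowupLimit_of_uniform_bounds`).
* **Step 7 (the contradiction) — proved here (§1) in the recorded special case `ε = 0`**
  (terminal slice IN `𝕃`, so the blow-up limit has ZERO final value): the print's Liouville-type
  Lemma 3.3 (only sketched there: "backward uniqueness … arguments similar to [Barker–Seregin]")
  is replaced by the tree's PROVED backward uniqueness for slab local Leray solutions with an
  arbitrary datum, `IsLocalLeraySolutionOn.ae_zero_of_final_vanishing_anyDatum`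
  (Lemarié-Rieusset 2016, Thm. 15.4 with the `L³` hypothesis removed): a local Leray solution on
  `(0,T) × ℝ³` whose slices tend to `0` weakly as `t ↑ T` vanishes a.e., hence has NO backward
  singular point on the top slice (`IsLocalLeraySolutionOn.not_isBackwardSingularPoint_of_final_vanishing`).
  What remains between Step 6 and Step 7 (the blow-up limit is a slab local Leray solution with
  vanishing final value) is sized in the memo.

Nothing accepted is restated: no `def`, no new named fact; the fact
`albrittonBarker2020_localWeakL3_regularity` is NOT discharged by this file.

## Mathlib / tree search

Reused by name: `IsSuitableWeakSolutionInBall(.zoom)`, `zoom_preimage_parabolicCylinder`,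
`IsSuitableWeakSolutionOn.stRescale`, `HasWeakSpatialGradientOn.stRescale`,
`ae_sliced_setLIntegral_ball_stRescale`, `setLIntegral_frobeniusNormSq_stRescale`,
`setLIntegral_enorm_rpow_stRescale`, `map_stAffine_volume_restrict_preimage`,
`map_space_affine_volume`, `integral_comp_space_affine`, `IsBackwardSingularPoint`,
`SuitableCompactness_holds`, `SuitableCompactness.isSuitableWeakSolutionInBall_of_le_radius`,
`PersistenceOfSingularities_holds`, `IsLocalLeraySolutionOn.ae_zero_of_final_vanishing_anyDatum`.
The slice tools of §3 are private copies of the PRIVATE tools of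
`AlbrittonBarker2020LocalConcentration.lean` (not importable). `lean search` for
`zoom_radius|blowupSequence|not_isBackwardSingularPoint_of_final|singular_limit_of_uniform`:
nothing (2026-08-28).

## References

* D. Albritton, T. Barker, J. Differential Equations 269 (2020) 7529–7573 = arXiv:1811.00507, §3:
  Thm. 3.1, Steps 1–7 of its proof, Lemma 3.3, Rmk. 3.4. [`AlbrittonBarker2020`]
* P. G. Lemarié-Rieusset, *The Navier–Stokes Problem in the 21st Century* (2016), Thm. 15.4.
  [`LemarieRieusset2016`]
* L. Caffarelli, R. Kohn, L. Nirenberg, Comm. Pure Appl. Math. 35 (1982), §2 (scaling).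
  [`CaffarelliKohnNirenberg1982`]
-/

noncomputable section

open MeasureTheory TopologicalSpace Set Function Filter Metric Module
open _root_.Topology
open scoped ENNReal NNReal InnerProductSpace RealInnerProductSpace

namespace Literature.Analysis.FluidPDE

/-! ### §1. Step 7 with `ε = 0`: no singular point on the top slice of a slab local Leray solution
with vanishing final value -/

section Endgame

/-- **Albritton–Barker 2020, Step 7 of the proof of Thm. 3.1 in the case `ε = 0` (interior,
Rmk. 3.4), via Lemarié-Rieusset's backward uniqueness instead of Lemma 3.3.** If `(v, π)` is a
local Leray solution on the slab `(0,T) × ℝ³` (viscosity `ν > 0`, weakly divergence-free datum)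
whose slices tend to `0` weakly as `t ↑ T`, then no point `(T, x)` of the top slice is a backward
singular point of `v`: indeed `v = 0` a.e. on the slab
(`IsLocalLeraySolutionOn.ae_zero_of_final_vanishing_anyDatum`), so `v` is essentially bounded on
`Q((T,x), √T) ⊆ (0,T) × ℝ³`. In the print: "`v^∞` is essentially bounded in `ℝ³₊ × ]3/4,1[`. This
contradicts (3.37)" (c13).
[cite: AlbrittonBarker2020, proof of Thm. 3.1, Step 7 and Rmk. 3.4 (arXiv:1811.00507 §3.3); LemarieRieusset2016, Thm. 15.4] -/
theorem IsLocalLeraySolutionOn.not_isBackwardSingularPoint_of_final_vanishing {ν T : ℝ}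
    (hν : 0 < ν) (hT : 0 < T) {u₀ : EuclideanSpace ℝ (Fin 3) → EuclideanSpace ℝ (Fin 3)}
    {v : ℝ → EuclideanSpace ℝ (Fin 3) → EuclideanSpace ℝ (Fin 3)}
    {π : ℝ → EuclideanSpace ℝ (Fin 3) → ℝ}
    (hdiv : IsWeaklyDivFree u₀) (hv : IsLocalLeraySolutionOn T ν u₀ v π)
    (hfinal : ∀ φ : EuclideanSpace ℝ (Fin 3) → EuclideanSpace ℝ (Fin 3),
      FunctionSpaces.IsTestFunctionOn (⊤ : Opens (EuclideanSpace ℝ (Fin 3))) φ →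
        Tendsto (fun t => ∫ x, ⟪v t x, φ x⟫) (𝓝[<] T) (𝓝 0))
    (x : EuclideanSpace ℝ (Fin 3)) :
    ¬ IsBackwardSingularPoint v (T, x) := by
  intro hsing
  have hae := hv.ae_zero_of_final_vanishing_anyDatum hν hT hdiv hfinal
  -- the cylinder `Q((T,x), √T) = (0,T) × B(x,√T)` lies in the slab
  have hr : 0 < Real.sqrt T := Real.sqrt_pos.2 hT
  have hsub : parabolicCylinder (Real.sqrt T) ((T, x) : ℝ × EuclideanSpace ℝ (Fin 3)) ⊆
      Ioo (0 : ℝ) T ×ˢ (univ : Set (EuclideanSpace ℝ (Fin 3))) := by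
    rw [parabolicCylinder, Real.sq_sqrt hT.le, sub_self]
    exact prod_mono Subset.rfl (subset_univ _)
  have hae' : ∀ᵐ z ∂(volume.restrict
      (parabolicCylinder (Real.sqrt T) ((T, x) : ℝ × EuclideanSpace ℝ (Fin 3)))),
      uncurry v z = (0 : ℝ × EuclideanSpace ℝ (Fin 3) → EuclideanSpace ℝ (Fin 3)) z := by
    filter_upwards [ae_restrict_of_ae_restrict_of_subset hsub hae] with z hz
    exact hz
  have h0 : eLpNorm (uncurry v) ∞ (volume.restrict
      (parabolicCylinder (Real.sqrt T) ((T, x) : ℝ × EuclideanSpace ℝ (Fin 3)))) = 0 := by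
    rw [eLpNorm_congr_ae hae', eLpNorm_zero]
  have h := hsing (Real.sqrt T) hr
  rw [h0] at h
  exact ENNReal.zero_ne_top h

end Endgame

/-! ### §2. The zoom of the class `IsSuitableWeakSolutionInBall` with an arbitrary radius -/

section ZoomRadius

variable {u : ℝ → EuclideanSpace ℝ (Fin 3) → EuclideanSpace ℝ (Fin 3)}
  {p : ℝ → EuclideanSpace ℝ (Fin 3) → ℝ} {ρ R : ℝ} {z₁ : ℝ × EuclideanSpace ℝ (Fin 3)}

/-- **The zoom at scale `R` carries the class on `Q(z₁, ρ)` to the class on `Q(0, ρ/R)`**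
(Albritton–Barker 2019, Def. 2.1 is scale invariant; CKN 1982, §2): for
`U(s, y) = R u(t₁ + R² s, x₁ + R y)`, `P(s, y) = R² p(t₁ + R² s, x₁ + R y)` and `(u, p)` in the class
`IsSuitableWeakSolutionInBall ρ z₁`, the pair `(U, P)` is in the class on
`Q(0, ρ/R) = Φ⁻¹(Q(z₁, ρ))`, `Φ(s, y) = (t₁ + R² s, x₁ + R y)`. The accepted `.zoom` is the case
`ρ = R`; the proof is the same transport (`IsSuitableWeakSolutionOn.stRescale`,
`ae_sliced_setLIntegral_ball_stRescale`, `HasWeakSpatialGradientOn.stRescale`,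
`setLIntegral_frobeniusNormSq_stRescale`, `setLIntegral_enorm_rpow_stRescale`). In the print this
is the sentence "The above functions are defined on `Ω_k × ]0,1[`. Here, `Ω_k := Ω/R_k`" (c9,
Step 2). [cite: AlbrittonBarker2020, proof of Thm. 3.1, Step 2 (arXiv:1811.00507 §3.1); CaffarelliKohnNirenberg1982, §2] -/
theorem IsSuitableWeakSolutionInBall.zoom_radius (h : IsSuitableWeakSolutionInBall ρ z₁ u p)
    (hR : 0 < R) :
    IsSuitableWeakSolutionInBall (ρ / R) (0 : ℝ × EuclideanSpace ℝ (Fin 3))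
      (R • stPull (R ^ 2) R z₁.1 z₁.2 u) (R ^ 2 • stPull (R ^ 2) R z₁.1 z₁.2 p) := by
  obtain ⟨hsuit, ⟨C, hC⟩, ⟨G, hG, hG2⟩, hp⟩ := h
  have hR2 : 0 < R ^ 2 := pow_pos hR 2
  have hpre' : stAffine (R ^ 2) R z₁.1 z₁.2 ⁻¹' parabolicCylinder ρ z₁ =
      parabolicCylinder (ρ / R) (0 : ℝ × EuclideanSpace ℝ (Fin 3)) :=
    zoom_preimage_parabolicCylinder hR z₁ ρ
  have hpre : stPreimage (R ^ 2) R z₁.1 z₁.2 (parabolicCylinderOpens ρ z₁) =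
      parabolicCylinderOpens (ρ / R) (0 : ℝ × EuclideanSpace ℝ (Fin 3)) :=
    Opens.ext hpre'
  -- the local notion
  have hsuit1 : IsSuitableWeakSolutionOn
      (parabolicCylinderOpens (ρ / R) (0 : ℝ × EuclideanSpace ℝ (Fin 3))) 1 0
      (R • stPull (R ^ 2) R z₁.1 z₁.2 u) (R ^ 2 • stPull (R ^ 2) R z₁.1 z₁.2 p) := by
    have h0 := hsuit.stRescale hR hR (sq R) z₁.1 z₁.2
    have hvisc : R * 1 / R = 1 := by field_simp
    have hforce : ((R ^ 2 * R) • stPull (R ^ 2) R z₁.1 z₁.2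
        (0 : ℝ → EuclideanSpace ℝ (Fin 3) → EuclideanSpace ℝ (Fin 3))) = 0 := by
      funext s y; simp [stPull]
    rw [hvisc, hforce, hpre] at h0
    exact h0
  refine ⟨hsuit1, ?_, ?_, ?_⟩
  · -- energy class: slices over `(-(ρ/R)², 0) = Φ⁻¹` of `(t₁ - ρ², t₁)`
    have hC0 : ∀ᵐ t ∂(volume.restrict (Ioo (z₁.1 + R ^ 2 * (-(ρ / R) ^ 2)) (z₁.1 + R ^ 2 * 0))),
        ∫⁻ x in ball z₁.2 ρ, ‖u t x‖ₑ ^ 2 ≤ (C : ℝ≥0∞) := by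
      have e : Ioo (z₁.1 + R ^ 2 * (-(ρ / R) ^ 2)) (z₁.1 + R ^ 2 * 0) = Ioo (z₁.1 - ρ ^ 2) z₁.1 := by
        congr 1
        · field_simp
          ring
        · ring
      rw [e]
      exact hC
    have h2 := ae_sliced_setLIntegral_ball_stRescale hR2 hR z₁.1 z₁.2 z₁.2 ρ (-(ρ / R) ^ 2) 0
      (fun t x => ‖u t x‖ₑ ^ 2) hC0
    rw [finrank_euclideanSpace_fin, sub_self, smul_zero] at h2
    set C₁ : ℝ≥0∞ := ‖R‖ₑ ^ 2 * (ENNReal.ofReal (R ^ 3)⁻¹ * C) with hC₁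
    have hC₁top : C₁ ≠ ⊤ :=
      ENNReal.mul_ne_top (by simp) (ENNReal.mul_ne_top ENNReal.ofReal_ne_top ENNReal.coe_ne_top)
    refine ⟨C₁.toNNReal, ?_⟩
    rw [ENNReal.coe_toNNReal hC₁top]
    have hset : Ioo ((0 : ℝ × EuclideanSpace ℝ (Fin 3)).1 - (ρ / R) ^ 2)
        (0 : ℝ × EuclideanSpace ℝ (Fin 3)).1 = Ioo (-(ρ / R) ^ 2) 0 := by simp
    rw [hset]
    filter_upwards [h2] with s hs
    have e : ∀ y : EuclideanSpace ℝ (Fin 3), ‖(R • stPull (R ^ 2) R z₁.1 z₁.2 u) s y‖ₑ ^ 2 =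
        ‖R‖ₑ ^ 2 * ‖u (z₁.1 + R ^ 2 * s) (z₁.2 + R • y)‖ₑ ^ 2 := by
      intro y
      rw [smul_stPull_apply, enorm_smul, mul_pow]
    simp only [e]
    rw [lintegral_const_mul' _ _ (by simp)]
    refine mul_le_mul' le_rfl ?_
    have e0 : (0 : ℝ × EuclideanSpace ℝ (Fin 3)).2 = 0 := rfl
    rw [e0]
    exact hs
  · -- the gradient
    refine ⟨(R * R) • stPull (R ^ 2) R z₁.1 z₁.2 G, ?_, ?_⟩
    · rw [← hpre]
      exact hG.stRescale R hR2 hR z₁.1 z₁.2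
    · show ∫⁻ w in parabolicCylinder (ρ / R) (0 : ℝ × EuclideanSpace ℝ (Fin 3)),
          ENNReal.ofReal (frobeniusNormSq (((R * R) • stPull (R ^ 2) R z₁.1 z₁.2 G) w.1 w.2)) < ⊤
      rw [← hpre', setLIntegral_frobeniusNormSq_stRescale hR2 hR z₁.1 z₁.2 (R * R) G]
      exact ENNReal.mul_lt_top
        (ENNReal.mul_lt_top ENNReal.ofReal_lt_top ENNReal.ofReal_lt_top) hG2
  · -- the pressure class
    refine ⟨hsuit1.distributional.2.2.1.aestronglyMeasurable, ?_⟩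
    have h32 : ((3 : ℝ≥0∞) / 2).toReal = 3 / 2 := by
      rw [ENNReal.toReal_div]; norm_num
    have h32top : (3 : ℝ≥0∞) / 2 ≠ ⊤ := (ENNReal.div_lt_top (by simp) (by simp)).ne
    have hfin : ∫⁻ w in parabolicCylinder ρ z₁, ‖p w.1 w.2‖ₑ ^ (3 / 2 : ℝ) < ⊤ := by
      have hp' := hp.eLpNorm_lt_top
      rw [eLpNorm_eq_lintegral_rpow_enorm_toReal (by norm_num) h32top, h32] at hp'
      exact (ENNReal.rpow_lt_top_iff_of_pos (by norm_num : (0 : ℝ) < 1 / (3 / 2))).1 hp'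
    rw [eLpNorm_eq_lintegral_rpow_enorm_toReal (by norm_num) h32top, h32]
    refine ENNReal.rpow_lt_top_of_nonneg (by positivity) (ne_of_lt ?_)
    show ∫⁻ w in parabolicCylinder (ρ / R) (0 : ℝ × EuclideanSpace ℝ (Fin 3)),
        ‖(R ^ 2 • stPull (R ^ 2) R z₁.1 z₁.2 p) w.1 w.2‖ₑ ^ (3 / 2 : ℝ) < ⊤
    rw [← hpre', setLIntegral_enorm_rpow_stRescale hR2 hR z₁.1 z₁.2 (R ^ 2) p _ (by norm_num)]
    exact ENNReal.mul_lt_top (ENNReal.mul_lt_top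
      (ENNReal.rpow_lt_top_of_nonneg (by norm_num) enorm_ne_top) ENNReal.ofReal_lt_top) hfin

end ZoomRadius

/-! ### §3. Scaling tools for slices (private; copies of the private tools of
`AlbrittonBarker2020LocalConcentration.lean`, which are not importable) -/

section SliceTools

/-- Volume of preimages under the space dilation `y ↦ x₀ + γy` of `ℝ³`, for an ARBITRARY set.
[folklore] -/
private theorem volume_preimage_space_dilate {γ : ℝ} (hγ : 0 < γ)
    (x₀ : EuclideanSpace ℝ (Fin 3)) (B : Set (EuclideanSpace ℝ (Fin 3))) :
    volume ((fun y : EuclideanSpace ℝ (Fin 3) => x₀ + γ • y) ⁻¹' B) =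
      ENNReal.ofReal (γ ^ 3)⁻¹ * volume B := by
  have hme := (spaceAffineHomeomorph hγ.ne' x₀).measurableEmbedding
  have h := hme.map_apply (volume : Measure (EuclideanSpace ℝ (Fin 3))) B
  rw [coe_spaceAffineHomeomorph] at h
  rw [← h, map_space_affine_volume hγ x₀, Measure.smul_apply, smul_eq_mul,
    finrank_euclideanSpace_fin]

/-- **Superlevel sets of a dilated slice inside a ball**: for `α, γ > 0`,
`|{y ∈ B(0,ρ) : a < ‖α f(x₀ + γy)‖}| = γ⁻³ |{x ∈ B(x₀, γρ) : a/α < ‖f x‖}|` — the distribution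
function of `α f(x₀ + γ ·)` on `B(0,ρ)` against that of `f` on `B(x₀,γρ)`. [folklore] -/
private theorem restrict_ball_superlevel_space_dilate {α γ : ℝ} (hα : 0 < α) (hγ : 0 < γ)
    (x₀ : EuclideanSpace ℝ (Fin 3)) (f : EuclideanSpace ℝ (Fin 3) → EuclideanSpace ℝ (Fin 3))
    (a ρ : ℝ) :
    (volume.restrict (ball (0 : EuclideanSpace ℝ (Fin 3)) ρ))
        {y : EuclideanSpace ℝ (Fin 3) | a < ‖α • f (x₀ + γ • y)‖} =
      ENNReal.ofReal (γ ^ 3)⁻¹ *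
        (volume.restrict (ball x₀ (γ * ρ))) {x : EuclideanSpace ℝ (Fin 3) | a / α < ‖f x‖} := by
  rw [Measure.restrict_apply' measurableSet_ball, Measure.restrict_apply' measurableSet_ball]
  have hset : {y : EuclideanSpace ℝ (Fin 3) | a < ‖α • f (x₀ + γ • y)‖} ∩ ball 0 ρ =
      (fun y : EuclideanSpace ℝ (Fin 3) => x₀ + γ • y) ⁻¹'
        ({x : EuclideanSpace ℝ (Fin 3) | a / α < ‖f x‖} ∩ ball x₀ (γ * ρ)) := by
    ext y
    constructor
    · rintro ⟨h1, h2⟩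
      refine ⟨?_, ?_⟩
      · rw [mem_setOf_eq, norm_smul, Real.norm_eq_abs, abs_of_pos hα] at h1
        rw [mem_setOf_eq, div_lt_iff₀' hα]
        exact h1
      · rw [mem_ball_zero_iff] at h2
        rw [mem_ball, dist_eq_norm, add_sub_cancel_left, norm_smul, Real.norm_eq_abs, abs_of_pos hγ]
        exact mul_lt_mul_of_pos_left h2 hγ
    · rintro ⟨h1, h2⟩
      refine ⟨?_, ?_⟩
      · rw [mem_setOf_eq, div_lt_iff₀' hα] at h1
        rw [mem_setOf_eq, norm_smul, Real.norm_eq_abs, abs_of_pos hα]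
        exact h1
      · rw [mem_ball, dist_eq_norm, add_sub_cancel_left, norm_smul, Real.norm_eq_abs,
          abs_of_pos hγ] at h2
        rw [mem_ball_zero_iff]
        exact lt_of_mul_lt_mul_left h2 hγ.le
  rw [hset, volume_preimage_space_dilate hγ]

/-- **Essential suprema under the space–time rescaling**:
`ess sup_{Φ⁻¹(S)} ‖α u ∘ Φ‖ = |α| · ess sup_S ‖u‖`, `Φ(s,y) = (t₀ + βs, x₀ + γy)`. [folklore] -/
private theorem eLpNorm_top_smul_stPull_restrict_preimage {β γ : ℝ} (hβ : 0 < β) (hγ : 0 < γ) (t₀ : ℝ)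
    (x₀ : EuclideanSpace ℝ (Fin 3)) (α : ℝ)
    (u : ℝ → EuclideanSpace ℝ (Fin 3) → EuclideanSpace ℝ (Fin 3))
    (S : Set (ℝ × EuclideanSpace ℝ (Fin 3))) :
    eLpNorm (uncurry (α • stPull β γ t₀ x₀ u)) ∞ (volume.restrict (stAffine β γ t₀ x₀ ⁻¹' S)) =
      ‖α‖ₑ * eLpNorm (uncurry u) ∞ (volume.restrict S) := by
  have h1 : uncurry (α • stPull β γ t₀ x₀ u) = α • (uncurry u ∘ stAffine β γ t₀ x₀) := by
    funext z
    rfl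
  rw [h1, eLpNorm_const_smul]
  congr 1
  rw [← (measurableEmbedding_stAffine hβ.ne' hγ.ne' t₀ x₀).eLpNorm_map_measure,
    map_stAffine_volume_restrict_preimage hβ hγ, eLpNorm_exponent_top, eLpNorm_exponent_top]
  have hk : ENNReal.ofReal (β * γ ^ Module.finrank ℝ (EuclideanSpace ℝ (Fin 3)))⁻¹ ≠ 0 :=
    (ENNReal.ofReal_pos.2 (by positivity)).ne'
  refine le_antisymm (eLpNormEssSup_mono_measure _ Measure.smul_absolutelyContinuous)
    (eLpNormEssSup_mono_measure _ fun s hs => ?_)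
  simp only [Measure.smul_apply, smul_eq_mul, mul_eq_zero] at hs
  exact hs.resolve_left hk

/-- **Pairings of a dilated slice against a test field**: for `γ > 0`,
`∫ ⟪α f(x₀ + γy), φ(y)⟫ dy = α γ⁻³ ∫ ⟪f x, φ(γ⁻¹(x − x₀))⟫ dx`. [folklore] -/
private theorem integral_inner_space_dilate {γ : ℝ} (hγ : 0 < γ) (α : ℝ)
    (x₀ : EuclideanSpace ℝ (Fin 3)) (f φ : EuclideanSpace ℝ (Fin 3) → EuclideanSpace ℝ (Fin 3)) :
    ∫ y, ⟪α • f (x₀ + γ • y), φ y⟫ =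
      α * (γ ^ 3)⁻¹ * ∫ x, ⟪f x, φ (γ⁻¹ • (x - x₀))⟫ := by
  have h1 : ∀ y : EuclideanSpace ℝ (Fin 3), ⟪α • f (x₀ + γ • y), φ y⟫ =
      α * ⟪f (x₀ + γ • y), φ (γ⁻¹ • ((x₀ + γ • y) - x₀))⟫ := by
    intro y
    rw [real_inner_smul_left, add_sub_cancel_left, smul_smul, inv_mul_cancel₀ hγ.ne', one_smul]
  simp_rw [h1]
  rw [integral_const_mul, integral_comp_space_affine hγ x₀
    (fun x => ⟪f x, φ (γ⁻¹ • (x - x₀))⟫), finrank_euclideanSpace_fin, smul_eq_mul, mul_assoc]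

/-- `L²` is invariant under affine changes of variable: `φ(γ⁻¹(· − x₀)) ∈ L²` for `φ ∈ L²`,
`γ > 0`. [folklore] -/
private theorem memLp_two_comp_space_dilate_symm {γ : ℝ} (hγ : 0 < γ) (x₀ : EuclideanSpace ℝ (Fin 3))
    {φ : EuclideanSpace ℝ (Fin 3) → EuclideanSpace ℝ (Fin 3)} (hφ : MemLp φ 2 volume) :
    MemLp (fun x => φ (γ⁻¹ • (x - x₀))) 2 volume := by
  have e : (fun x : EuclideanSpace ℝ (Fin 3) => γ⁻¹ • (x - x₀)) =
      fun x => (-(γ⁻¹ • x₀)) + γ⁻¹ • x := by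
    funext x
    rw [smul_sub]
    abel
  have hmap : Measure.map (fun x : EuclideanSpace ℝ (Fin 3) => γ⁻¹ • (x - x₀)) volume =
      ENNReal.ofReal ((γ⁻¹) ^ Module.finrank ℝ (EuclideanSpace ℝ (Fin 3)))⁻¹ • volume := by
    rw [e]
    exact map_space_affine_volume (inv_pos.2 hγ) _
  have h2 : MemLp φ 2 (Measure.map (fun x : EuclideanSpace ℝ (Fin 3) => γ⁻¹ • (x - x₀)) volume) := by
    rw [hmap]
    exact hφ.smul_measure ENNReal.ofReal_ne_top
  have hmeas : AEMeasurable (fun x : EuclideanSpace ℝ (Fin 3) => γ⁻¹ • (x - x₀)) volume :=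
    ((measurable_id.sub_const x₀).const_smul γ⁻¹).aemeasurable
  exact h2.comp_of_map hmeas

end SliceTools

/-! ### §4. Step 2 of the printed proof: the zoom at the vertex `z* = (1, x*)` -/

section BlowupZoom

variable {xs : EuclideanSpace ℝ (Fin 3)} {θ : ℝ}
  {v : ℝ → EuclideanSpace ℝ (Fin 3) → EuclideanSpace ℝ (Fin 3)}
  {q : ℝ → EuclideanSpace ℝ (Fin 3) → ℝ}

/-- The zoom `U(s,y) = θ v(1 + θ² s, x* + θ y)` evaluated. [folklore] -/
private theorem blowupZoom_apply (θ : ℝ) (xs : EuclideanSpace ℝ (Fin 3))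
    (v : ℝ → EuclideanSpace ℝ (Fin 3) → EuclideanSpace ℝ (Fin 3)) (s : ℝ)
    (y : EuclideanSpace ℝ (Fin 3)) :
    (θ • stPull (θ ^ 2) θ (1 : ℝ) xs v) s y = θ • v (1 + θ ^ 2 * s) (xs + θ • y) :=
  smul_stPull_apply θ (θ ^ 2) θ 1 xs v s y

/-- **Step 2, the class** (c9: "`V^{(k)}(y,s) := R_k V(R_k y, t_k + R_k² s)` … defined on
`Ω_k × ]0,1[`, `Ω_k := Ω/R_k`"; interior case, `Ω = B(x*,1)`, vertex normalised to the origin):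
the zoom at scale `θ > 0` of a pair in the class on `Q((1,x*), 1) = Ω × ]0,1[` is in the class on
`Q(0, 1/θ) = ]−1/θ², 0[ × B(0, 1/θ)`.
[cite: AlbrittonBarker2020, proof of Thm. 3.1, Step 2 (arXiv:1811.00507 §3.1)] -/
theorem IsSuitableWeakSolutionInBall.blowupZoom
    (h : IsSuitableWeakSolutionInBall 1 ((1 : ℝ), xs) v q) (hθ : 0 < θ) :
    IsSuitableWeakSolutionInBall (1 / θ) (0 : ℝ × EuclideanSpace ℝ (Fin 3))
      (θ • stPull (θ ^ 2) θ (1 : ℝ) xs v) (θ ^ 2 • stPull (θ ^ 2) θ (1 : ℝ) xs q) :=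
  h.zoom_radius hθ

/-- Preimage of the cylinders `]0,t[ × B(x*,1)`, `t = 1 + θ² s'`, under the zoom:
`Φ⁻¹(]0, 1 + θ²s'[ × B(x*,1)) = ]−1/θ², s'[ × B(0, 1/θ)`. [folklore] -/
private theorem blowupZoom_preimage_cylinder_below (hθ : 0 < θ) (xs : EuclideanSpace ℝ (Fin 3)) (s' : ℝ) :
    stAffine (θ ^ 2) θ (1 : ℝ) xs ⁻¹' (Ioo (0 : ℝ) (1 + θ ^ 2 * s') ×ˢ ball xs 1) =
      Ioo (-(1 / θ) ^ 2) s' ×ˢ ball (0 : EuclideanSpace ℝ (Fin 3)) (1 / θ) := by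
  rw [stAffine_preimage_cylinder (pow_pos hθ 2) hθ (1 : ℝ) xs xs]
  have e1 : ((0 : ℝ) - 1) / θ ^ 2 = -(1 / θ) ^ 2 := by
    rw [zero_sub, neg_div, div_pow, one_pow]
  have e2 : (1 + θ ^ 2 * s' - 1) / θ ^ 2 = s' := by
    field_simp
    ring
  have e3 : θ⁻¹ • (xs - xs) = (0 : EuclideanSpace ℝ (Fin 3)) := by rw [sub_self, smul_zero]
  rw [e1, e2, e3]

/-- **Step 2, boundedness below the top time** ((3.1) transported: `v ∈ L_∞(Ω × ]0,t[)` for all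
`t < 1` gives `U ∈ L_∞(]−1/θ², s'[ × B(0,1/θ))` for all `−1/θ² < s' < 0`).
[cite: AlbrittonBarker2020, proof of Thm. 3.1, Steps 1–2 ((3.1), (3.2); arXiv:1811.00507 §3.1)] -/
theorem blowupZoom_eLpNorm_top_lt_top_below (hθ : 0 < θ)
    (hbdd : ∀ t ∈ Ioo (0 : ℝ) 1,
      eLpNorm (uncurry v) ∞ (volume.restrict (Ioo (0 : ℝ) t ×ˢ ball xs 1)) < ∞) :
    ∀ s' ∈ Ioo (-(1 / θ) ^ 2) (0 : ℝ),
      eLpNorm (uncurry (θ • stPull (θ ^ 2) θ (1 : ℝ) xs v)) ∞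
        (volume.restrict (Ioo (-(1 / θ) ^ 2) s' ×ˢ ball (0 : EuclideanSpace ℝ (Fin 3)) (1 / θ))) < ∞ := by
  intro s' hs'
  have hθ2 : 0 < θ ^ 2 := pow_pos hθ 2
  have ht : 1 + θ ^ 2 * s' ∈ Ioo (0 : ℝ) 1 := by
    have h1 : -(1 / θ) ^ 2 < s' := hs'.1
    have h2 : s' < 0 := hs'.2
    have h3 : (1 / θ) ^ 2 * θ ^ 2 = 1 := by field_simp
    constructor
    · nlinarith
    · nlinarith
  rw [← blowupZoom_preimage_cylinder_below hθ xs s',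
    eLpNorm_top_smul_stPull_restrict_preimage hθ2 hθ 1 xs θ v]
  exact ENNReal.mul_lt_top enorm_lt_top (hbdd _ ht)

/-- **Step 2, weak continuity of the slices** (the footnote to Def. 2.1, `v ∈ C_w(L²)`,
transported): if `t ↦ ∫⟪v(t), w⟫` is continuous on `]0,1]` for every `w ∈ L²` supported in
`B(x*,1)`, then `s ↦ ∫⟪U(s), φ⟫` is continuous on `]−1/θ², 0]` for every `φ ∈ L²` supported in
`B(0,1/θ)` (`∫⟪U(s),φ⟫ = θ·θ⁻³ ∫⟪v(1 + θ²s), φ(θ⁻¹(· − x*))⟫`).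
[cite: AlbrittonBarker2020, Def. 2.1 (footnote 3) and proof of Thm. 3.1, Step 2 (arXiv:1811.00507 §2, §3.1)] -/
theorem blowupZoom_continuousOn_integral_inner (hθ : 0 < θ)
    (hwc : ∀ w : EuclideanSpace ℝ (Fin 3) → EuclideanSpace ℝ (Fin 3), MemLp w 2 volume →
      Function.support w ⊆ ball xs 1 →
      ContinuousOn (fun t => ∫ x, ⟪v t x, w x⟫) (Ioc (0 : ℝ) 1)) :
    ∀ φ : EuclideanSpace ℝ (Fin 3) → EuclideanSpace ℝ (Fin 3), MemLp φ 2 volume →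
      Function.support φ ⊆ ball (0 : EuclideanSpace ℝ (Fin 3)) (1 / θ) →
      ContinuousOn (fun s => ∫ y, ⟪(θ • stPull (θ ^ 2) θ (1 : ℝ) xs v) s y, φ y⟫)
        (Ioc (-(1 / θ) ^ 2) (0 : ℝ)) := by
  intro φ hφ hφs
  set w : EuclideanSpace ℝ (Fin 3) → EuclideanSpace ℝ (Fin 3) :=
    fun x => φ (θ⁻¹ • (x - xs)) with hwdef
  have hwL2 : MemLp w 2 volume := memLp_two_comp_space_dilate_symm hθ xs hφ
  have hws : Function.support w ⊆ ball xs 1 := by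
    intro x hx
    have hx' : θ⁻¹ • (x - xs) ∈ ball (0 : EuclideanSpace ℝ (Fin 3)) (1 / θ) := hφs hx
    rw [mem_ball, dist_zero_right, norm_smul, Real.norm_eq_abs, abs_of_pos (inv_pos.2 hθ),
      one_div, mul_lt_iff_lt_one_right (inv_pos.2 hθ)] at hx'
    · rw [mem_ball, dist_eq_norm]
      exact hx'
  have key : ∀ s : ℝ, ∫ y, ⟪(θ • stPull (θ ^ 2) θ (1 : ℝ) xs v) s y, φ y⟫ =
      θ * (θ ^ 3)⁻¹ * ∫ x, ⟪v (1 + θ ^ 2 * s) x, w x⟫ := by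
    intro s
    have e : (fun y => ⟪(θ • stPull (θ ^ 2) θ (1 : ℝ) xs v) s y, φ y⟫) =
        fun y => ⟪θ • v (1 + θ ^ 2 * s) (xs + θ • y), φ y⟫ := by
      funext y; rw [blowupZoom_apply]
    rw [e]
    exact integral_inner_space_dilate hθ θ xs (v (1 + θ ^ 2 * s)) φ
  have hcont := hwc w hwL2 hws
  have hmaps : MapsTo (fun s : ℝ => 1 + θ ^ 2 * s) (Ioc (-(1 / θ) ^ 2) (0 : ℝ)) (Ioc (0 : ℝ) 1) := by
    intro s hs
    have h3 : (1 / θ) ^ 2 * θ ^ 2 = 1 := by field_simp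
    have hθ2 : 0 < θ ^ 2 := pow_pos hθ 2
    constructor <;> nlinarith [hs.1, hs.2]
  have haff : ContinuousOn (fun s : ℝ => 1 + θ ^ 2 * s) (Ioc (-(1 / θ) ^ 2) (0 : ℝ)) :=
    (by fun_prop : Continuous fun s : ℝ => 1 + θ ^ 2 * s).continuousOn
  have hcomp := (hcont.comp haff hmaps).const_smul (θ * (θ ^ 3)⁻¹)
  rw [show (fun s => ∫ y, ⟪(θ • stPull (θ ^ 2) θ (1 : ℝ) xs v) s y, φ y⟫) =
    fun s => θ * (θ ^ 3)⁻¹ * ∫ x, ⟪v (1 + θ ^ 2 * s) x, w x⟫ from funext key]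
  exact hcomp

/-- **Step 2, the slices in distribution form** (the Navier–Stokes scaling on a time slice,
CKN 1982 §2, as used for (3.6)): for every time `s`, radius `ρ` and level `a`,
`|{y ∈ B(0,ρ/θ) : a < ‖U(s,y)‖}| = θ⁻³ |{x ∈ B(x*,ρ) : a/θ < ‖v(1 + θ²s, x)‖}|`.
[cite: AlbrittonBarker2020, proof of Thm. 3.1, Step 2, (3.6) (arXiv:1811.00507 §3.1); CaffarelliKohnNirenberg1982, §2 (scaling)] -/
theorem blowupZoom_restrict_ball_superlevel (hθ : 0 < θ) (xs : EuclideanSpace ℝ (Fin 3))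
    (v : ℝ → EuclideanSpace ℝ (Fin 3) → EuclideanSpace ℝ (Fin 3)) (s ρ a : ℝ) :
    (volume.restrict (ball (0 : EuclideanSpace ℝ (Fin 3)) (ρ / θ)))
        {y : EuclideanSpace ℝ (Fin 3) | a < ‖(θ • stPull (θ ^ 2) θ (1 : ℝ) xs v) s y‖} =
      ENNReal.ofReal (θ ^ 3)⁻¹ *
        (volume.restrict (ball xs ρ))
          {x : EuclideanSpace ℝ (Fin 3) | a / θ < ‖v (1 + θ ^ 2 * s) x‖} := by
  have h1 := restrict_ball_superlevel_space_dilate hθ hθ xs (v (1 + θ ^ 2 * s)) a (ρ / θ)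
  rw [mul_div_cancel₀ _ hθ.ne'] at h1
  have e : {y : EuclideanSpace ℝ (Fin 3) | a < ‖(θ • stPull (θ ^ 2) θ (1 : ℝ) xs v) s y‖} =
      {y : EuclideanSpace ℝ (Fin 3) | a < ‖θ • v (1 + θ ^ 2 * s) (xs + θ • y)‖} := by
    ext y
    rw [mem_setOf_eq, mem_setOf_eq, blowupZoom_apply]
  rw [e]
  exact h1

/-- **Step 2, scale invariance of the weak-`L³` quasi-norm in distribution form** ((3.6),
"`sup_k ‖V^k(·,0)‖_{L₃^weak(Ω_k)} = M' < ∞`", transported without loss): a bound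
`a³ |{x ∈ B(x*,ρ) : a < ‖v(t,x)‖}| ≤ B` for all `a > 0` at a time `t = 1 + θ²s` gives the same
bound `a³ |{y ∈ B(0,ρ/θ) : a < ‖U(s,y)‖}| ≤ B` for all `a > 0`.
[cite: AlbrittonBarker2020, proof of Thm. 3.1, Step 2, (3.6) (arXiv:1811.00507 §3.1)] -/
theorem blowupZoom_weakL3_superlevel_le (hθ : 0 < θ) {s ρ : ℝ} {B : ℝ≥0∞}
    (hB : ∀ a : ℝ, 0 < a →
      ENNReal.ofReal (a ^ 3) *
          (volume.restrict (ball xs ρ))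
            {x : EuclideanSpace ℝ (Fin 3) | a < ‖v (1 + θ ^ 2 * s) x‖} ≤ B) :
    ∀ a : ℝ, 0 < a →
      ENNReal.ofReal (a ^ 3) *
          (volume.restrict (ball (0 : EuclideanSpace ℝ (Fin 3)) (ρ / θ)))
            {y : EuclideanSpace ℝ (Fin 3) | a < ‖(θ • stPull (θ ^ 2) θ (1 : ℝ) xs v) s y‖} ≤ B := by
  intro a ha
  rw [blowupZoom_restrict_ball_superlevel hθ xs v s ρ a]
  have ha3 : a ^ 3 = θ ^ 3 * (a / θ) ^ 3 := by
    field_simp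
  rw [ha3, ENNReal.ofReal_mul (pow_pos hθ 3).le]
  calc ENNReal.ofReal (θ ^ 3) * ENNReal.ofReal ((a / θ) ^ 3) * (ENNReal.ofReal (θ ^ 3)⁻¹ *
        (volume.restrict (ball xs ρ))
          {x : EuclideanSpace ℝ (Fin 3) | a / θ < ‖v (1 + θ ^ 2 * s) x‖})
      = ENNReal.ofReal (θ ^ 3) * ENNReal.ofReal (θ ^ 3)⁻¹ * (ENNReal.ofReal ((a / θ) ^ 3) *
        (volume.restrict (ball xs ρ))
          {x : EuclideanSpace ℝ (Fin 3) | a / θ < ‖v (1 + θ ^ 2 * s) x‖}) := by ring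
    _ = ENNReal.ofReal ((a / θ) ^ 3) *
        (volume.restrict (ball xs ρ))
          {x : EuclideanSpace ℝ (Fin 3) | a / θ < ‖v (1 + θ ^ 2 * s) x‖} := by
        rw [← ENNReal.ofReal_mul (pow_pos hθ 3).le, mul_inv_cancel₀ (pow_pos hθ 3).ne',
          ENNReal.ofReal_one, one_mul]
    _ ≤ B := hB (a / θ) (div_pos ha hθ)

/-- Preimages of the backward cylinders at the vertex: `Φ⁻¹(Q((1,x*), θr)) = Q(0, r)`. [folklore] -/
private theorem blowupZoom_preimage_parabolicCylinder (hθ : 0 < θ) (xs : EuclideanSpace ℝ (Fin 3)) (r : ℝ) :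
    stAffine (θ ^ 2) θ (1 : ℝ) xs ⁻¹' parabolicCylinder (θ * r) ((1 : ℝ), xs) =
      parabolicCylinder r (0 : ℝ × EuclideanSpace ℝ (Fin 3)) := by
  have h := zoom_preimage_parabolicCylinder hθ (((1 : ℝ), xs) : ℝ × EuclideanSpace ℝ (Fin 3)) (θ * r)
  rw [mul_div_cancel_left₀ r hθ.ne'] at h
  exact h

/-- **Step 2, the vertex** ((3.5) "`z* = (x*,1)` is a singular point of `v`" transported, and
conversely): the origin is a backward singular point of the zoom `U` iff `z* = (1,x*)` is a
backward singular point of `v` (`ess sup_{Q(0,r)} ‖U‖ = θ · ess sup_{Q(z*,θr)} ‖v‖`).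
[cite: AlbrittonBarker2020, proof of Thm. 3.1, (3.5) and Step 5, (3.24) (arXiv:1811.00507 §3)] -/
theorem blowupZoom_isBackwardSingularPoint_iff (hθ : 0 < θ) :
    IsBackwardSingularPoint (θ • stPull (θ ^ 2) θ (1 : ℝ) xs v) (0 : ℝ × EuclideanSpace ℝ (Fin 3)) ↔
      IsBackwardSingularPoint v ((1 : ℝ), xs) := by
  have hθ2 : 0 < θ ^ 2 := pow_pos hθ 2
  have hθe : ‖θ‖ₑ ≠ 0 := by simp [hθ.ne']
  have key : ∀ r : ℝ, eLpNorm (uncurry (θ • stPull (θ ^ 2) θ (1 : ℝ) xs v)) ∞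
      (volume.restrict (parabolicCylinder r (0 : ℝ × EuclideanSpace ℝ (Fin 3)))) =
      ‖θ‖ₑ * eLpNorm (uncurry v) ∞ (volume.restrict (parabolicCylinder (θ * r) ((1 : ℝ), xs))) := by
    intro r
    rw [← blowupZoom_preimage_parabolicCylinder hθ xs r,
      eLpNorm_top_smul_stPull_restrict_preimage hθ2 hθ 1 xs θ v]
  constructor
  · intro h r hr
    have h1 := h (r / θ) (div_pos hr hθ)
    rw [key, mul_div_cancel₀ _ hθ.ne'] at h1
    exact (ENNReal.mul_eq_top.1 h1).elim (fun h2 => h2.2) fun h2 => absurd h2.1 enorm_ne_top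
  · intro h r hr
    rw [key, h (θ * r) (mul_pos hθ hr)]
    exact ENNReal.mul_top hθe

end BlowupZoom

/-! ### §5. Step 2 assembled along the sequence `t_k ↑ 1`: the blow-up sequence -/

section BlowupSequence

/-- **Albritton–Barker 2020, proof of Thm. 3.1, Step 2 assembled (interior case, unit ball,
terminal slice in `𝕃`).** Under the hypotheses of `albrittonBarker2020_localWeakL3_regularity` at
the centre `x*` (class on `Q((1,x*),1) = Ω × ]0,1[`, boundedness below the top, weakly continuous
slices, weak-`L³` bound `M` on `B(x*,R)` along `t_k ↑ 1`, terminal slice weak-`L³` with vanishing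
local quasi-norm at `x*`) and the contradiction hypothesis "(3.5) `z* = (x*,1)` is a singular point",
the scales `θ_k = R_k = √(1 − t_k) ↓ 0` and the zooms `U_k(s,y) = θ_k v(1 + θ_k² s, x* + θ_k y)`,
`P_k = θ_k² q(…)` satisfy, for every `k`: `(U_k, P_k)` is in the class on `Q(0, 1/θ_k)`; `U_k` is
bounded on `]−1/θ_k², s'[ × B(0,1/θ_k)` for every `s' < 0`; its slices are weakly `L²`-continuous on
`]−1/θ_k², 0]`; (3.6) `‖U_k(·,−1)‖_{L^{3,∞}(B(0,R/θ_k))} ≤ M` (the time `t_k` is `s = −1`); the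
terminal slice `U_k(·,0)` has weak-`L³` quasi-norm `≤ A` on `B(0,1/θ_k)` and `≤ δ` on `B(0, r(δ)/θ_k)`
— radii blowing up as `k → ∞`, which is the print's "`Y^{(k)} ⇀* 0`" (c12) in quantitative form;
and the origin is a singular point of `U_k` ((3.24)). Everything by §2–§4.
[cite: AlbrittonBarker2020, proof of Thm. 3.1, Steps 2 and 5 ((3.5)–(3.8), (3.24); arXiv:1811.00507 §3)] -/
theorem albrittonBarker2020_blowupSequence (xs : EuclideanSpace ℝ (Fin 3)) (R M : ℝ)
    (v : ℝ → EuclideanSpace ℝ (Fin 3) → EuclideanSpace ℝ (Fin 3))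
    (q : ℝ → EuclideanSpace ℝ (Fin 3) → ℝ)
    (hcls : IsSuitableWeakSolutionInBall 1 ((1 : ℝ), xs) v q)
    (hbdd : ∀ t ∈ Ioo (0 : ℝ) 1,
      eLpNorm (uncurry v) ∞ (volume.restrict (Ioo (0 : ℝ) t ×ˢ ball xs 1)) < ∞)
    (hwc : ∀ w : EuclideanSpace ℝ (Fin 3) → EuclideanSpace ℝ (Fin 3), MemLp w 2 volume →
      Function.support w ⊆ ball xs 1 →
      ContinuousOn (fun t => ∫ x, ⟪v t x, w x⟫) (Ioc (0 : ℝ) 1))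
    {s : ℕ → ℝ} (hsmono : StrictMono s) (hsI : ∀ k, s k ∈ Ioo (0 : ℝ) 1)
    (hs1 : Tendsto s atTop (𝓝 1))
    (hsM : ∀ (k : ℕ) (a : ℝ), 0 < a →
      ENNReal.ofReal (a ^ 3) *
          (volume.restrict (ball xs R)) {x : EuclideanSpace ℝ (Fin 3) | a < ‖v (s k) x‖} ≤
        ENNReal.ofReal (M ^ 3))
    {A : ℝ} (hA : ∀ a : ℝ, 0 < a →
      ENNReal.ofReal (a ^ 3) *
          (volume.restrict (ball xs 1)) {x : EuclideanSpace ℝ (Fin 3) | a < ‖v 1 x‖} ≤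
        ENNReal.ofReal A)
    (hvan : ∀ δ : ℝ, 0 < δ → ∃ r : ℝ, 0 < r ∧ ∀ a : ℝ, 0 < a →
      ENNReal.ofReal (a ^ 3) *
          (volume.restrict (ball xs r)) {x : EuclideanSpace ℝ (Fin 3) | a < ‖v 1 x‖} ≤
        ENNReal.ofReal (δ ^ 3))
    (hsing : IsBackwardSingularPoint v ((1 : ℝ), xs)) :
    ∃ θ : ℕ → ℝ, (∀ k, 0 < θ k ∧ θ k < 1 ∧ θ k ^ 2 = 1 - s k) ∧ StrictAnti θ ∧
      Tendsto θ atTop (𝓝 0) ∧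
      ∀ k,
        -- the class on `Q(0, 1/θ_k)`
        IsSuitableWeakSolutionInBall (1 / θ k) (0 : ℝ × EuclideanSpace ℝ (Fin 3))
          (θ k • stPull (θ k ^ 2) (θ k) (1 : ℝ) xs v) (θ k ^ 2 • stPull (θ k ^ 2) (θ k) (1 : ℝ) xs q) ∧
        -- bounded below the top time
        (∀ s' ∈ Ioo (-(1 / θ k) ^ 2) (0 : ℝ),
          eLpNorm (uncurry (θ k • stPull (θ k ^ 2) (θ k) (1 : ℝ) xs v)) ∞
            (volume.restrict (Ioo (-(1 / θ k) ^ 2) s' ×ˢ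
              ball (0 : EuclideanSpace ℝ (Fin 3)) (1 / θ k))) < ∞) ∧
        -- weakly continuous slices on `]−1/θ_k², 0]`
        (∀ φ : EuclideanSpace ℝ (Fin 3) → EuclideanSpace ℝ (Fin 3), MemLp φ 2 volume →
          Function.support φ ⊆ ball (0 : EuclideanSpace ℝ (Fin 3)) (1 / θ k) →
          ContinuousOn (fun s => ∫ y, ⟪(θ k • stPull (θ k ^ 2) (θ k) (1 : ℝ) xs v) s y, φ y⟫)
            (Ioc (-(1 / θ k) ^ 2) (0 : ℝ))) ∧
        -- (3.6): the weak-`L³` bound at `s = -1` on `B(0, R/θ_k)`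
        (∀ a : ℝ, 0 < a →
          ENNReal.ofReal (a ^ 3) *
              (volume.restrict (ball (0 : EuclideanSpace ℝ (Fin 3)) (R / θ k)))
                {y : EuclideanSpace ℝ (Fin 3) |
                  a < ‖(θ k • stPull (θ k ^ 2) (θ k) (1 : ℝ) xs v) (-1) y‖} ≤
            ENNReal.ofReal (M ^ 3)) ∧
        -- the terminal slice: weak-`L³` on `B(0, 1/θ_k)` …
        (∀ a : ℝ, 0 < a →
          ENNReal.ofReal (a ^ 3) *
              (volume.restrict (ball (0 : EuclideanSpace ℝ (Fin 3)) (1 / θ k)))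
                {y : EuclideanSpace ℝ (Fin 3) |
                  a < ‖(θ k • stPull (θ k ^ 2) (θ k) (1 : ℝ) xs v) 0 y‖} ≤
            ENNReal.ofReal A) ∧
        -- … and small on balls of radius `r(δ)/θ_k → ∞`
        (∀ δ : ℝ, 0 < δ → ∃ r : ℝ, 0 < r ∧ ∀ k' : ℕ, ∀ a : ℝ, 0 < a →
          ENNReal.ofReal (a ^ 3) *
              (volume.restrict (ball (0 : EuclideanSpace ℝ (Fin 3)) (r / θ k')))
                {y : EuclideanSpace ℝ (Fin 3) |
                  a < ‖(θ k' • stPull (θ k' ^ 2) (θ k') (1 : ℝ) xs v) 0 y‖} ≤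
            ENNReal.ofReal (δ ^ 3)) ∧
        -- (3.24): the origin is a singular point of `U_k`
        IsBackwardSingularPoint (θ k • stPull (θ k ^ 2) (θ k) (1 : ℝ) xs v)
          (0 : ℝ × EuclideanSpace ℝ (Fin 3)) := by
  set θ : ℕ → ℝ := fun k => Real.sqrt (1 - s k) with hθdef
  have h1s : ∀ k, 0 < 1 - s k := fun k => by linarith [(hsI k).2]
  have hθpos : ∀ k, 0 < θ k := fun k => Real.sqrt_pos.2 (h1s k)
  have hθsq : ∀ k, θ k ^ 2 = 1 - s k := fun k => Real.sq_sqrt (h1s k).le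
  have hθlt : ∀ k, θ k < 1 := by
    intro k
    have h1 : 1 - s k < 1 := by linarith [(hsI k).1]
    have h2 : Real.sqrt (1 - s k) < Real.sqrt 1 := Real.sqrt_lt_sqrt (h1s k).le h1
    rwa [Real.sqrt_one] at h2
  refine ⟨θ, fun k => ⟨hθpos k, hθlt k, hθsq k⟩, ?_, ?_, fun k => ⟨?_, ?_, ?_, ?_, ?_, ?_, ?_⟩⟩
  · -- `θ` is strictly decreasing
    intro a b hab
    exact Real.sqrt_lt_sqrt (h1s b).le (by linarith [hsmono hab])
  · -- `θ_k → 0`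
    have h1 : Tendsto (fun k => 1 - s k) atTop (𝓝 (1 - 1)) := hs1.const_sub 1
    rw [sub_self] at h1
    have h2 := (Real.continuous_sqrt.tendsto 0).comp h1
    rwa [Real.sqrt_zero] at h2
  · exact hcls.blowupZoom (hθpos k)
  · exact blowupZoom_eLpNorm_top_lt_top_below (hθpos k) hbdd
  · exact blowupZoom_continuousOn_integral_inner (hθpos k) hwc
  · -- the time `t_k` is `s = -1`: `1 + θ_k² · (-1) = s k`
    have e : 1 + θ k ^ 2 * (-1 : ℝ) = s k := by rw [hθsq k]; ring
    have hB : ∀ a : ℝ, 0 < a →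
        ENNReal.ofReal (a ^ 3) *
            (volume.restrict (ball xs R))
              {x : EuclideanSpace ℝ (Fin 3) | a < ‖v (1 + θ k ^ 2 * (-1 : ℝ)) x‖} ≤
          ENNReal.ofReal (M ^ 3) := by
      rw [e]
      exact hsM k
    exact blowupZoom_weakL3_superlevel_le (hθpos k) hB
  · -- the terminal time `1` is `s = 0`
    have e : 1 + θ k ^ 2 * (0 : ℝ) = 1 := by ring
    have hB : ∀ a : ℝ, 0 < a →
        ENNReal.ofReal (a ^ 3) *
            (volume.restrict (ball xs 1))
              {x : EuclideanSpace ℝ (Fin 3) | a < ‖v (1 + θ k ^ 2 * (0 : ℝ)) x‖} ≤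
          ENNReal.ofReal A := by
      rw [e]
      exact hA
    exact blowupZoom_weakL3_superlevel_le (hθpos k) hB
  · intro δ hδ
    obtain ⟨r, hr, hrδ⟩ := hvan δ hδ
    refine ⟨r, hr, fun k' => ?_⟩
    have e : 1 + θ k' ^ 2 * (0 : ℝ) = 1 := by ring
    have hB : ∀ a : ℝ, 0 < a →
        ENNReal.ofReal (a ^ 3) *
            (volume.restrict (ball xs r))
              {x : EuclideanSpace ℝ (Fin 3) | a < ‖v (1 + θ k' ^ 2 * (0 : ℝ)) x‖} ≤
          ENNReal.ofReal (δ ^ 3) := by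
      rw [e]
      exact hrδ
    exact blowupZoom_weakL3_superlevel_le (hθpos k') hB
  · exact (blowupZoom_isBackwardSingularPoint_iff (hθpos k)).2 hsing

end BlowupSequence

/-! ### §6. Steps 5–6 by name: a singular limit from uniform bounds (compactness + persistence) -/

section SingularLimit

/-- **Albritton–Barker 2020, proof of Thm. 3.1, Step 6 in the interior case (Rmk. 3.4) — the
passage to the limit and (3.37), BY NAME from the tree.** Let `(U_k, P_k)` be suitable weak
solutions in the unit parabolic ball `Q(0,1)` (class of A–B 2019, Def. 2.1), each with the origin
as a backward singular point, and uniformly bounded in `L³ × L^{3/2}(Q(0,1))` (the shape in which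
Step 3/4's a priori bounds are consumed). Then along a subsequence `σ` they converge — strongly in
`L³(Q(0,R))`, the pressures weakly in `L^{3/2}(Q(0,R))`, every `R < 1` — to a suitable weak
solution `(u,p)` in the balls `Q(0,R)` **with the origin a backward singular point of `u`**: the
tree's `SuitableCompactness_holds` (A–B 2019 Lemma 2.2 = Lin 1998) followed by
`PersistenceOfSingularities_holds` (A–B 2019 Prop. 2.3 = Rusin–Šverák 2011), the `limsup`
hypothesis of the latter being trivial since every `U_{σ(j)}` is itself unbounded on each `Q(0,R)`.
In the print: "we can extract a diagonal subsequence that converges … see Lemma 2.7. This and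
(3.24) allow us to apply Proposition A.4 concerning the stability of singular points … Hence
`(0,1)` is a singular point of `(v^∞, q^∞)`" (c12).
[cite: AlbrittonBarker2020, proof of Thm. 3.1, Step 6, (3.35)–(3.37) and Rmk. 3.4 (arXiv:1811.00507 §3.3); AlbrittonBarker2019, Lemma 2.2, Prop. 2.3] -/
theorem exists_singular_limit_of_uniform_bounds
    (U : ℕ → ℝ → EuclideanSpace ℝ (Fin 3) → EuclideanSpace ℝ (Fin 3))
    (P : ℕ → ℝ → EuclideanSpace ℝ (Fin 3) → ℝ)
    (hcls : ∀ k, IsSuitableWeakSolutionInBall 1 (0 : ℝ × EuclideanSpace ℝ (Fin 3)) (U k) (P k))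
    (hbd : (⨆ k, eLpNorm (uncurry (U k)) 3
        (volume.restrict (parabolicCylinder 1 (0 : ℝ × EuclideanSpace ℝ (Fin 3)))) +
      eLpNorm (uncurry (P k)) (3 / 2)
        (volume.restrict (parabolicCylinder 1 (0 : ℝ × EuclideanSpace ℝ (Fin 3))))) < ∞)
    (hsing : ∀ k, IsBackwardSingularPoint (U k) (0 : ℝ × EuclideanSpace ℝ (Fin 3))) :
    ∃ (u : ℝ → EuclideanSpace ℝ (Fin 3) → EuclideanSpace ℝ (Fin 3))
      (p : ℝ → EuclideanSpace ℝ (Fin 3) → ℝ) (σ : ℕ → ℕ), StrictMono σ ∧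
      IsBackwardSingularPoint u (0 : ℝ × EuclideanSpace ℝ (Fin 3)) ∧
      ∀ R ∈ Ioo (0 : ℝ) 1,
        IsSuitableWeakSolutionInBall R 0 u p ∧
        MemLp (uncurry u) 3 (volume.restrict (parabolicCylinder R (0 : ℝ × EuclideanSpace ℝ (Fin 3)))) ∧
        Tendsto (fun j => eLpNorm (uncurry (U (σ j)) - uncurry u) 3
          (volume.restrict (parabolicCylinder R (0 : ℝ × EuclideanSpace ℝ (Fin 3))))) atTop (𝓝 0) ∧
        ∀ g : ℝ × EuclideanSpace ℝ (Fin 3) → ℝ,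
          MemLp g 3 (volume.restrict (parabolicCylinder R (0 : ℝ × EuclideanSpace ℝ (Fin 3)))) →
          Tendsto (fun j => ∫ w in parabolicCylinder R (0 : ℝ × EuclideanSpace ℝ (Fin 3)),
              P (σ j) w.1 w.2 * g w)
            atTop (𝓝 (∫ w in parabolicCylinder R (0 : ℝ × EuclideanSpace ℝ (Fin 3)), p w.1 w.2 * g w)) := by
  obtain ⟨u, p, σ, hσ, hconv⟩ := SuitableCompactness_holds U P hcls hbd
  refine ⟨u, p, σ, hσ, ?_, hconv⟩
  -- persistence of singularities along the subsequence
  have hbd' : (⨆ j, eLpNorm (uncurry (U (σ j))) 3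
        (volume.restrict (parabolicCylinder 1 (0 : ℝ × EuclideanSpace ℝ (Fin 3)))) +
      eLpNorm (uncurry (P (σ j))) (3 / 2)
        (volume.restrict (parabolicCylinder 1 (0 : ℝ × EuclideanSpace ℝ (Fin 3))))) < ∞ :=
    lt_of_le_of_lt (iSup_comp_le (fun k => eLpNorm (uncurry (U k)) 3
        (volume.restrict (parabolicCylinder 1 (0 : ℝ × EuclideanSpace ℝ (Fin 3)))) +
      eLpNorm (uncurry (P k)) (3 / 2)
        (volume.restrict (parabolicCylinder 1 (0 : ℝ × EuclideanSpace ℝ (Fin 3))))) σ) hbd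
  refine PersistenceOfSingularities_holds (fun j => U (σ j)) (fun j => P (σ j)) u p
    (fun j => hcls (σ j)) hbd' (fun R hR => ?_) (fun R hR => ?_)
  · obtain ⟨h1, -, h3, h4⟩ := hconv R hR
    exact ⟨h1, h3, h4⟩
  · have e : (fun j => eLpNorm (uncurry (U (σ j))) ∞
        (volume.restrict (parabolicCylinder R (0 : ℝ × EuclideanSpace ℝ (Fin 3))))) =
        fun _ => (∞ : ℝ≥0∞) := funext fun j => hsing (σ j) R hR.1
    rw [e, limsup_const]

/-- **Steps 2, 5 and 6 combined for the blow-up sequence of Thm. 3.1 (interior, unit ball).**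
Under the hypotheses of `albrittonBarker2020_blowupSequence` (in particular "(3.5) `z*` is
singular"), IF the zooms `(U_k, P_k)` at the scales `θ_k = √(1 − t_k)` are uniformly bounded in
`L³ × L^{3/2}` on the unit ball `Q(0,1)` — the output shape of the print's Steps 1, 3, 4 (the a
priori estimates (3.12), (3.14)–(3.18)), which this file does NOT prove — then a subsequence
converges to a suitable weak solution in the balls `Q(0,R)`, `R < 1`, which is singular at the
origin. (The print's limit lives on `ℝ³ × ]1/2,1[`; the balls `Q(0,a)`, `a > 1`, are reached by
the same statement applied to the zooms at the scales `a θ_k`, §4.)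
[cite: AlbrittonBarker2020, proof of Thm. 3.1, Steps 2, 5, 6 (arXiv:1811.00507 §3)] -/
theorem albrittonBarker2020_singular_blowupLimit_of_uniform_bounds (xs : EuclideanSpace ℝ (Fin 3))
    (v : ℝ → EuclideanSpace ℝ (Fin 3) → EuclideanSpace ℝ (Fin 3))
    (q : ℝ → EuclideanSpace ℝ (Fin 3) → ℝ)
    (hcls : IsSuitableWeakSolutionInBall 1 ((1 : ℝ), xs) v q)
    (hsing : IsBackwardSingularPoint v ((1 : ℝ), xs))
    {θ : ℕ → ℝ} (hθ : ∀ k, 0 < θ k ∧ θ k ≤ 1)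
    (hbd : (⨆ k, eLpNorm (uncurry (θ k • stPull (θ k ^ 2) (θ k) (1 : ℝ) xs v)) 3
        (volume.restrict (parabolicCylinder 1 (0 : ℝ × EuclideanSpace ℝ (Fin 3)))) +
      eLpNorm (uncurry (θ k ^ 2 • stPull (θ k ^ 2) (θ k) (1 : ℝ) xs q)) (3 / 2)
        (volume.restrict (parabolicCylinder 1 (0 : ℝ × EuclideanSpace ℝ (Fin 3))))) < ∞) :
    ∃ (u : ℝ → EuclideanSpace ℝ (Fin 3) → EuclideanSpace ℝ (Fin 3))
      (p : ℝ → EuclideanSpace ℝ (Fin 3) → ℝ) (σ : ℕ → ℕ), StrictMono σ ∧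
      IsBackwardSingularPoint u (0 : ℝ × EuclideanSpace ℝ (Fin 3)) ∧
      ∀ R ∈ Ioo (0 : ℝ) 1,
        IsSuitableWeakSolutionInBall R 0 u p ∧
        MemLp (uncurry u) 3 (volume.restrict (parabolicCylinder R (0 : ℝ × EuclideanSpace ℝ (Fin 3)))) ∧
        Tendsto (fun j => eLpNorm
            (uncurry (θ (σ j) • stPull (θ (σ j) ^ 2) (θ (σ j)) (1 : ℝ) xs v) - uncurry u) 3
          (volume.restrict (parabolicCylinder R (0 : ℝ × EuclideanSpace ℝ (Fin 3))))) atTop (𝓝 0) ∧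
        ∀ g : ℝ × EuclideanSpace ℝ (Fin 3) → ℝ,
          MemLp g 3 (volume.restrict (parabolicCylinder R (0 : ℝ × EuclideanSpace ℝ (Fin 3)))) →
          Tendsto (fun j => ∫ w in parabolicCylinder R (0 : ℝ × EuclideanSpace ℝ (Fin 3)),
              (θ (σ j) ^ 2 • stPull (θ (σ j) ^ 2) (θ (σ j)) (1 : ℝ) xs q) w.1 w.2 * g w)
            atTop (𝓝 (∫ w in parabolicCylinder R (0 : ℝ × EuclideanSpace ℝ (Fin 3)), p w.1 w.2 * g w)) := by
  refine exists_singular_limit_of_uniform_bounds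
    (fun k => θ k • stPull (θ k ^ 2) (θ k) (1 : ℝ) xs v)
    (fun k => θ k ^ 2 • stPull (θ k ^ 2) (θ k) (1 : ℝ) xs q) (fun k => ?_) hbd (fun k => ?_)
  · -- the class on `Q(0,1) ⊆ Q(0, 1/θ_k)`
    have h1 : (1 : ℝ) ≤ 1 / θ k := by
      rw [le_div_iff₀ (hθ k).1, one_mul]
      exact (hθ k).2
    exact SuitableCompactness.isSuitableWeakSolutionInBall_of_le_radius (hcls.blowupZoom (hθ k).1) one_pos h1
  · exact (blowupZoom_isBackwardSingularPoint_iff (hθ k).1).2 hsing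

end SingularLimit

end Literature.Analysis.FluidPDE

end
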